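import Mathlib
import HarnessLib
import Summits.MatrixMultiplication.MatrixMultiplication.Theorems.FarEdgeDescentWidthTransform
import Summits.MatrixMultiplication.MatrixMultiplication.Theorems.FarEdgeDescentFloorDial
import Summits.MatrixMultiplication.MatrixMultiplication.Theorems.FarEdgeDescentFixedPointWedge
import Summits.MatrixMultiplication.MatrixMultiplication.Theorems.FarEdgeDescentFixedPointPinning

/-!
# Far-edge descent, kernel XLII-A (3/3) — every schedule is wedged and pinned (model level)

Kernel XL-A (`FarEdgeDescentWidthTransform`) reduced the width cascade of the β-dial to two scalars
per node, the SHARE `λ = L/(Q+βL)` and the NARROWNESS `V(z) = p(z)/(z·L) ∈ [0,1]`, with the exact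
product rules `λ_P = λ + λ' − (2β−1)λλ'` and
`V_P·λ_P = λ'(1−βλ)·V' + λ(1−βλ')·V + z·λλ'·V·V'`.  Kernel XLI (`FarEdgeDescentFloorDial`,
`FarEdgeDescentTreeCap`) typed the cap conjecture XL-D over all binary schedules `Sched` and proved it
along chains and caterpillars; memo g61 §3 recorded why the tree case resisted: every potential in
`V` alone fails at LIGHT bases, and the pair criterion is false on the full box `λ ≤ 1/β, V ≤ 1`.

Kernel XLII-A (three files: `…FixedPointWedge`, `…FixedPointPinning`, `…PinnedSchedules`) isolates
the structural law that removes the bad corner of the box.  Write `d := 1 − (2β−1)·λ` (so `d = 0`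
is the fixed point `λ* = 1/(2β−1)` of the share map, `d < 0` the LIGHT side, `d > 0` the HEAVY side,
and `β−1+β·d ≥ 0 ⟺ λ ≤ 1/β`).  Then `d` is MULTIPLICATIVE (`d_P = d·d'`), and two inequalities are
closed under products and hold at every base:
* WEDGE (W): `β·(−d) ≤ (β−1)·V` — a light node is narrow in proportion to its lightness;
* PINNING (Q): `|d| ≤ V²` — a node whose legs have spread (`V` small) is pinned to the fixed point,
  quadratically, and a very heavy node is narrow.

THIS FILE: the schedule level, over the grammar `Sched` of XLI-A (`FarEdgeDescentFloorDial`).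
`narrow β z s = p_s(z)/(z·L_s)`, `dfix β s = 1 − (2β−1)·share`, `BasesNonneg`; the product rules
`narrow_node_mul` (from XL-A `transform_product`) and `dfix_node` (from XLI-A `share_node`);
`dfix_range`; and the **pinning theorem** `pinning`: for `3/2 ≤ β ≤ 2`, `9/10 ≤ z`, every schedule
with nonnegative base anchors has `Q ≥ 0`, `L > 0`, `V(z) ≥ 0`, satisfies (W) and (Q) — by structural
induction, bases having `V = 1` and `d = 1 − (2β−1)/(b+β) ∈ (−(β−1)/β, 1)`, nodes by
`wedge_closure` / `pin_closure`.  `pinning_of_admissible`: every `Admissible` schedule of XLI-A has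
`|1 − (2β−1)·share| ≤ V(z)²` and `β((2β−1)·share − 1) ≤ (β−1)·V(z)`.
CONSEQUENCE (memo g62 §2–3): deep nodes (`V(z)` small, as the floors of XXXIX-G force) have share
within `V²/(2β−1)` of `λ*`; the pair criterion of the cap argument then only has to hold on the thin
region (W)∧(Q)∧floors, where memo g62 §3 verifies it numerically for the explicit potential
`Φ = λ·(1/50 + 1 − V(24/25))` at every sampled `β ∈ [3/2, 1.995]`.

HONEST FRAMING: MODEL level (real numbers; the dictionary node ↦ `(Q, p)` is kernels XXXIX-K/XL-A);
no `sorry`, no new axioms; the only definitions are the abbreviations `narrow`, `dfix`, `BasesNonneg`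
over the XLI-A grammar.  Nothing here touches `_root_.MatrixMultiplication` or the `closes` cut
of the route.  References: Schönhage 1981 [Schonhage1981]; Coppersmith–Winograd
[CoppersmithWinograd1990]; kernels XL-A, XLI-A/B; memo g62 (decomp-mm-lens-2).
-/

noncomputable section

set_option linter.dupNamespace false

namespace Summit.MatrixMultiplication.MatrixMultiplication.Theorems.FarEdgeDescentPinnedSchedules

/-! ## Schedules: every schedule with nonnegative base anchors is wedged and pinned

We work over the schedule grammar `Sched` of kernel XLI-A (`FarEdgeDescentFloorDial`): a base
`base b` has anchor `b` and profile `X`; a node is the product.  The narrowness at scale `z` is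
`narrow β z s = p_s(z)/(z·L_s)` and the fixed-point coordinate is `dfix β s = 1 − (2β−1)·share`. -/

open Polynomial
open Summit.MatrixMultiplication.MatrixMultiplication.Theorems.FarEdgeDescentWidthTransform
open Summit.MatrixMultiplication.MatrixMultiplication.Theorems.FarEdgeDescentFloorDial
open Summit.MatrixMultiplication.MatrixMultiplication.Theorems.FarEdgeDescentFloorDial.Sched
open Summit.MatrixMultiplication.MatrixMultiplication.Theorems.FarEdgeDescentFixedPointWedge
open Summit.MatrixMultiplication.MatrixMultiplication.Theorems.FarEdgeDescentFixedPointPinning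

/-- Narrowness of a schedule at scale `z`: `V(z) = p(z)/(z·L)`. -/
def narrow (β z : ℝ) (s : Sched) : ℝ := (profile β s).eval z / (z * legMass β s)

/-- Fixed-point coordinate `d = 1 − (2β−1)·λ` of a schedule. -/
def dfix (β : ℝ) (s : Sched) : ℝ := 1 - (2 * β - 1) * share β s

/-- All base anchors of the schedule are nonnegative (implied by `Admissible`). -/
def BasesNonneg : Sched → Prop
  | base b => 0 ≤ b
  | node s t => BasesNonneg s ∧ BasesNonneg t

/-- Admissible schedules (XLI-A) have nonnegative base anchors. -/
theorem basesNonneg_of_admissible {a β : ℝ} : ∀ s : Sched, Admissible a β s → BasesNonneg s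
  | base _, h => h.1
  | node s t, h => ⟨basesNonneg_of_admissible s h.1, basesNonneg_of_admissible t h.2.1⟩

/-- A base has profile `X`. -/
theorem profile_base (β b : ℝ) : profile β (base b) = X := rfl

/-- A base has anchor `b`. -/
theorem anchor_base (β b : ℝ) : anchor β (base b) = b := rfl

/-- A base is maximally narrow: `V(z) = 1` (`z ≠ 0`). -/
theorem narrow_base {β z : ℝ} (hz : z ≠ 0) (b : ℝ) : narrow β z (base b) = 1 := by
  simp [narrow, profile_base, legMass_base, hz]

/-- `d` of a base: `1 − (2β−1)/(b+β)`. -/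
theorem dfix_base (β b : ℝ) : dfix β (base b) = 1 - (2 * β - 1) * (1 / (b + β)) := by
  simp [dfix, share_base]

/-- Anchor of a product. -/
theorem anchor_node (β : ℝ) (s t : Sched) :
    anchor β (node s t) = anchor β s * anchor β t + β * (β - 1) * legMass β s * legMass β t :=
  (qp_node β s t).1

/-- Transform of a product's profile: `p_P(z) = Q·p'(z) + Q'·p(z) + p(z)·p'(z)`. -/
theorem profile_node_eval (β z : ℝ) (s t : Sched) :
    (profile β (node s t)).eval z =
      anchor β s * (profile β t).eval z + anchor β t * (profile β s).eval z +
        (profile β s).eval z * (profile β t).eval z := by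
  rw [(qp_node β s t).2, transform_product]

/-- `p(z) = z·L·V(z)` when `z ≠ 0`, `L ≠ 0`. -/
theorem eval_eq_narrow {β z : ℝ} (hz : z ≠ 0) {s : Sched} (hL : legMass β s ≠ 0) :
    (profile β s).eval z = z * legMass β s * narrow β z s := by
  unfold narrow
  field_simp

/-- **Narrowness product rule for schedules** (multiplied through):
`V_P·(Q·L' + Q'·L + L·L') = Q·L'·V' + Q'·L·V + z·L·L'·V·V'`. -/
theorem narrow_node_mul {β z : ℝ} (hz : z ≠ 0) {s t : Sched} (hLs : legMass β s ≠ 0)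
    (hLt : legMass β t ≠ 0) (hLP : legMass β (node s t) ≠ 0) :
    narrow β z (node s t) *
        (anchor β s * legMass β t + anchor β t * legMass β s + legMass β s * legMass β t) =
      anchor β s * legMass β t * narrow β z t + anchor β t * legMass β s * narrow β z s +
        z * legMass β s * legMass β t * narrow β z s * narrow β z t := by
  have key : (profile β (node s t)).eval z =
      z * (anchor β s * legMass β t * narrow β z t + anchor β t * legMass β s * narrow β z s +
        z * legMass β s * legMass β t * narrow β z s * narrow β z t) := by
    rw [profile_node_eval, eval_eq_narrow hz hLs, eval_eq_narrow hz hLt]; ring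
  have e := eval_eq_narrow hz hLP
  rw [← legMass_node]
  have h2 : z * (narrow β z (node s t) * legMass β (node s t)) =
      z * (anchor β s * legMass β t * narrow β z t + anchor β t * legMass β s * narrow β z s +
        z * legMass β s * legMass β t * narrow β z s * narrow β z t) := by
    rw [← key, e]; ring
  exact mul_left_cancel₀ hz h2

/-- `d` of a product is the product of the `d`'s (when both `Q + βL ≠ 0`). -/
theorem dfix_node {β : ℝ} {s t : Sched} (hs : anchor β s + β * legMass β s ≠ 0)
    (ht : anchor β t + β * legMass β t ≠ 0) :
    dfix β (node s t) = dfix β s * dfix β t := by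
  unfold dfix
  rw [share_node hs ht]
  ring

/-- Share coordinates: `Q = r(1 − βλ)`, `L = rλ` with `r = Q + βL ≠ 0`. -/
theorem share_coords {β : ℝ} {s : Sched} (hr : anchor β s + β * legMass β s ≠ 0) :
    anchor β s = (anchor β s + β * legMass β s) * (1 - β * share β s) ∧
    legMass β s = (anchor β s + β * legMass β s) * share β s := by
  unfold share
  have hL : (anchor β s + β * legMass β s) * (legMass β s / (anchor β s + β * legMass β s)) =
      legMass β s := by
    rw [mul_div_assoc', mul_div_cancel_left₀ _ hr]
  constructor
  · linear_combination β * hL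
  · exact hL.symm

/-- Range of `d` for a schedule with `Q ≥ 0`, `L > 0`, `β > 0`:
`β − 1 + β·d ≥ 0` (share at most `1/β`) and `d < 1` (positive share). -/
theorem dfix_range {β : ℝ} (hβ : 1 < β) {s : Sched} (hQ : 0 ≤ anchor β s) (hL : 0 < legMass β s) :
    0 ≤ β - 1 + β * dfix β s ∧ dfix β s < 1 := by
  have hβ0 : 0 < β := by linarith
  have hr : 0 < anchor β s + β * legMass β s := by positivity
  have hsh : share β s = legMass β s / (anchor β s + β * legMass β s) := rfl
  have hshpos : 0 < share β s := by rw [hsh]; positivity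
  have hshle : β * share β s ≤ 1 := by
    rw [hsh, mul_div_assoc', div_le_one hr]; linarith
  unfold dfix
  constructor
  · have e : β - 1 + β * (1 - (2 * β - 1) * share β s) = (2 * β - 1) * (1 - β * share β s) := by
      ring
    rw [e]
    exact mul_nonneg (by linarith) (by linarith)
  · have := mul_pos (show (0:ℝ) < 2 * β - 1 by linarith) hshpos
    linarith

/-- **Pinning theorem (schedules).**  For `3/2 ≤ β ≤ 2` and `9/10 ≤ z`, every schedule with
nonnegative base anchors has `Q ≥ 0`, `L > 0`, `V(z) ≥ 0`, satisfies the WEDGE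
`β·((2β−1)λ − 1) ≤ (β−1)·V(z)` and is PINNED: `|1 − (2β−1)λ| ≤ V(z)²`. -/
theorem pinning {β z : ℝ} (hβ : 3 / 2 ≤ β) (hβ2 : β ≤ 2) (hz : 9 / 10 ≤ z) :
    ∀ s : Sched, BasesNonneg s →
      0 ≤ anchor β s ∧ 0 < legMass β s ∧ 0 ≤ narrow β z s ∧
      β * (-(dfix β s)) ≤ (β - 1) * narrow β z s ∧ |dfix β s| ≤ narrow β z s ^ 2
  | base b, hb => by
      have hb' : (0 : ℝ) ≤ b := hb
      have hz0 : z ≠ 0 := by intro h; rw [h] at hz; norm_num at hz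
      have hbb : 0 < b + β := by linarith
      rw [anchor_base, legMass_base, narrow_base hz0, dfix_base]
      set u := 1 / (b + β) with hu
      have hu0 : 0 < u := by positivity
      have hβu : β * u ≤ 1 := by
        rw [hu, mul_one_div, div_le_one hbb]; linarith
      refine ⟨hb', one_pos, zero_le_one, ?_, ?_⟩
      · nlinarith
      · rw [one_pow, abs_le]
        constructor
        · nlinarith
        · nlinarith
  | node s t, h => by
      obtain ⟨hQs, hLs, hVs, hWs, hPs⟩ := pinning hβ hβ2 hz s h.1
      obtain ⟨hQt, hLt, hVt, hWt, hPt⟩ := pinning hβ hβ2 hz t h.2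
      have hβ0 : 0 < β := by linarith
      have hβ1 : 1 < β := by linarith
      have hz0 : z ≠ 0 := by intro h; rw [h] at hz; norm_num at hz
      have hrs : 0 < anchor β s + β * legMass β s := by positivity
      have hrt : 0 < anchor β t + β * legMass β t := by positivity
      obtain ⟨hds, hds1⟩ := dfix_range hβ1 hQs hLs
      obtain ⟨hdt, hdt1⟩ := dfix_range hβ1 hQt hLt
      -- the product's anchor and leg mass
      have hQP : 0 ≤ anchor β (node s t) := by
        rw [anchor_node]
        have : 0 ≤ β * (β - 1) := mul_nonneg hβ0.le (by linarith)
        positivity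
      have hLP : 0 < legMass β (node s t) := by
        rw [legMass_node]; positivity
      -- the product rule in share coordinates, then in d-coordinates
      have hmul := narrow_node_mul hz0 hLs.ne' hLt.ne' hLP.ne'
      obtain ⟨hQc, hLc⟩ := share_coords hrs.ne'
      obtain ⟨hQc', hLc'⟩ := share_coords hrt.ne'
      have hlam := narrowness_product_share (β := β) (z := z) (V := narrow β z s)
        (V' := narrow β z t) (VP := narrow β z (node s t)) hrs.ne' hrt.ne' hQc hLc hQc' hLc' hmul
      have hP : narrow β z (node s t) * ((2 * β - 1) * (1 - dfix β s * dfix β t)) =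
          (1 - dfix β t) * (β - 1 + β * dfix β s) * narrow β z t +
          (1 - dfix β s) * (β - 1 + β * dfix β t) * narrow β z s +
          z * (1 - dfix β s) * (1 - dfix β t) * narrow β z s * narrow β z t :=
        narrow_prod_dform hlam
      rw [dfix_node hrs.ne' hrt.ne']
      refine ⟨hQP, hLP, ?_, ?_, ?_⟩
      · exact narrow_prod_nonneg hβ1 (by linarith) hds hds1 hdt hdt1 hVs hVt hP
      · exact wedge_closure hβ1 (by linarith) hds hds1 hdt hdt1 hVs hVt hWs hWt hP
      · exact pin_closure hβ hβ2 hz hds hds1 hdt hdt1 hVs hVt hWs hWt hPs hPt hP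

/-- **Corollary (admissible schedules are pinned).**  Under the floor grammar of XLI-A every
admissible schedule has its share within `V(z)²/(2β−1)` of the fixed point `1/(2β−1)`, and a light
node (`(2β−1)λ > 1`) is narrow in proportion: `(β−1)·V(z) ≥ β·((2β−1)λ − 1)`. -/
theorem pinning_of_admissible {a β z : ℝ} (hβ : 3 / 2 ≤ β) (hβ2 : β ≤ 2) (hz : 9 / 10 ≤ z)
    (s : Sched) (hs : Admissible a β s) :
    |1 - (2 * β - 1) * share β s| ≤ narrow β z s ^ 2 ∧
      β * ((2 * β - 1) * share β s - 1) ≤ (β - 1) * narrow β z s := by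
  obtain ⟨-, -, -, hW, hQ⟩ := pinning hβ hβ2 hz s (basesNonneg_of_admissible s hs)
  refine ⟨hQ, ?_⟩
  have : β * (-(dfix β s)) = β * ((2 * β - 1) * share β s - 1) := by unfold dfix; ring
  linarith [hW, this]

end Summit.MatrixMultiplication.MatrixMultiplication.Theorems.FarEdgeDescentPinnedSchedules
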